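import Literature.NumberTheory.Automorphic.UnitaryLatticeTreeFixedCosetFlags      -- ★ (this seat) FILE 1: the dictionaries (A)(B)(I) WITH VALUES `exists_fixedBy_equiv_fixed_selfDual_rankN` ∕ `…_conj_equiv_fixed_type` ∕ `…_inf_equiv_fixed_flags_rankN`
import Literature.NumberTheory.Automorphic.HermitianLatticeTreePeriodDictionary   -- ★ (B-p04 (g35)) §2 the GENERIC per-level transfer `HermitianLatticeTree.natCard_quotient_orbitRel_fixedBy_eq_of_equivariant` (pure group theory)
import HarnessLib

/-!
# Per-period fixed-coset counts of `U(σ, H) ⧸ K₀`, `⧸ K₁`, `⧸ (K₀ ⊓ K₁)` at `γ` = per-period counts of `γ`-fixed self-dual ∕ type-`d` vertices ∕ flags of the lattice graph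
# (Kottwitz 1988 §2; Serre, *Trees* I.6.4, II.1.1) — any rank `N`, any form `H`; the COSET SIDE of the non-elliptic Euler–Poincaré relation

Topic `NumberTheory/Automorphic`; namespace `Literature.NumberTheory.Automorphic.UnitaryLatticeTree`.  THEOREMS ONLY (no definition ∕ instance ∕ notation ∕ named fact ∕ `sorry`).
Cell `pub/hodgecm-mathlib`, crux H413 = `stmt-HodgeConjecture-24833` (`--supports` lane, helper), LH6 rung-0 residue, CENSUS «EP-G» v1 (F0P3a-p09) §5 brick (G1) «(N)-G», COSET SIDE,
FILE 1 of 2 (FILE 2 = ★-to-be `UnitaryLatticeTreePeriodRelation`: the `N = 3` apartment and the sum).  Seat LH6-p03 (g8).  The rank-2 twin is ★ `HermitianLatticeTreePeriodDictionary` §3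
(B-p04 (g35)); its §2 `natCard_quotient_orbitRel_fixedBy_eq_of_equivariant` is PURE GROUP THEORY and is re-used here by name (not restated).  HONEST LABEL: count-neutral orbit
counting through equivariant bijections (nothing printed is asserted); HC_CM is proved only modulo the 7 printed citations (2 remaining named inputs hLiu418 = stmt-HodgeConjecture-24832,
h413 = stmt-HodgeConjecture-24833) until rung 0 closes.

THE MATHEMATICS.  `U = U(σ, H) ≤ GL_N(K)`, `K₀ = U ∩ GL_N(𝒪) = Stab_U(L₀)`, `K₁ = U ∩ g₁ GL_N(𝒪) g₁⁻¹ = Stab_U(g₁·L₀)`, `γ, τ ∈ U` COMMUTING; `τ` acts on `U ⧸ C` by left translation (through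
`τ^ℤ ≤ Z_U(γ)`, the currency of ★ `classOrbitalIntegral_indicator_complex_eq_mul_natCard_quotient_zpowers`: `ν(C)⁻¹ Φ(⟦γ⟧, 𝟙_C) = #(Fix_γ(U⧸C)∕τ^ℤ)`) and on the vertices by the
permutation `perm τ := latticeGraphPerm σ ϖ H τ` (`v ↦ τ·v`).  ★ FILE 1 gives bijections WITH VALUES `Fix_γ(U⧸K₀) ≃ F_A` (`uK₀ ↦ u·L₀`, fixed self-dual vertices), `Fix_γ(U⧸K₁) ≃ F_d`
(`uK₁ ↦ (u g₁)·L₀`, fixed type-`d` vertices), `Fix_γ(U⧸(K₀ ⊓ K₁)) ≃ Fl` (`u ↦ (u·L₀, (u g₁)·L₀)`, fixed flags); by their value clauses they intertwine `τ^n` on cosets with `(perm τ)^n` on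
vertices (`(τ^n u)·L₀ = τ^n·(u·L₀)`), so the PER-PERIOD counts agree, level by level (and one side is finite iff the other is).
* §1 `latticeGraphPerm_apply_coe`, `latticeGraphPerm_mul`, `latticeGraphPerm_zpow`, `latticeGraphPerm_zpow_smul_coe` (the action is multiplicative; `(perm τ)^n • v = τ^n · v`).
* §2 the three levels ON ANY MODEL `eU : G ≃* U` with the level `C ≤ G` given by MEMBERSHIP through `eU` (the currency of the CM consumer, `eU = localNonsplitEquiv …`, as ★
  `HermitianLatticeTreePeriodDictionary` §3): **`natCard_quotient_orbitRel_fixedBy_glInt_eq_rankN`** (`C ↔ GL_N(𝒪)`: fixed self-dual vertices), **`…_conj_glInt_eq_rankN`** (`C ↔ g₁GL_N(𝒪)g₁⁻¹`: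
  fixed type-`d` vertices), **`…_inf_eq_rankN`** (both: fixed flags), each `= ∧ (Finite ↔ Finite)`; the coset transport along `eU` is ★ `exists_equiv_fixedBy_quotient_congr`.

## References
* [Kottwitz1988] R. E. Kottwitz, *Tamagawa numbers*, Ann. of Math. 127 (1988), 629–646, §2 Theorem 2.
* [Serre1980Trees] J.-P. Serre, *Trees* (1980), Ch. I §6.4 (quotients by an automorphism group), Ch. II §1.1.
* [Laumon1995] G. Laumon, *Cohomology of Drinfeld Modular Varieties* I (1996), Lemma (5.3.2) (orbital integrals as counts of fixed facets modulo the centraliser).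
* [Kottwitz1986] R. E. Kottwitz, *Base change for unit elements of Hecke algebras*, Compositio Math. 60 (1986), §3 (fixed cosets = stable lattices).
-/

set_option autoImplicit false

noncomputable section

open Matrix MulAction Literature.NumberTheory.Automorphic
open Literature.NumberTheory.Automorphic.HermitianLattice Literature.NumberTheory.Automorphic.UnitaryGroup
open scoped Matrix MatrixGroups WithZero Valued

namespace Literature.NumberTheory.Automorphic.UnitaryLatticeTree

variable {K : Type*} [Field K] [Valued K ℤᵐ⁰] [ValuativeRel K] [(Valued.v : Valuation K ℤᵐ⁰).Compatible] {N : ℕ}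

/-! ## §1 The action of `U(σ, H)` on the vertices is multiplicative -/

section Action

variable (σ : K →+* K) (ϖ : K) (H : Matrix (Fin N) (Fin N) K)

omit [ValuativeRel K] [(Valued.v : Valuation K ℤᵐ⁰).Compatible] in
/-- `perm u v` has underlying lattice `u · v`. [cite: Serre1980Trees, II.1.1] -/
theorem latticeGraphPerm_apply_coe (u : ↥(unitaryGroupOfForm σ H)) (v : {M : Submodule (Valued.integer K) (Fin N → K) // IsVertex σ ϖ H M}) :
    ((latticeGraphPerm σ ϖ H u v : {M : Submodule (Valued.integer K) (Fin N → K) // IsVertex σ ϖ H M}) : Submodule (Valued.integer K) (Fin N → K)) =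
      mapGL (u : GL (Fin N) K) v.1 := rfl

omit [ValuativeRel K] [(Valued.v : Valuation K ℤᵐ⁰).Compatible] in
/-- `perm (u u′) = perm u ∘ perm u′`. [cite: Serre1980Trees, II.1.1] -/
theorem latticeGraphPerm_mul (u u' : ↥(unitaryGroupOfForm σ H)) :
    latticeGraphPerm σ ϖ H (u * u') = latticeGraphPerm σ ϖ H u * latticeGraphPerm σ ϖ H u' := by
  refine Equiv.ext fun v => Subtype.ext ?_
  change mapGL (((u * u' : ↥(unitaryGroupOfForm σ H))) : GL (Fin N) K) v.1 = mapGL (u : GL (Fin N) K) (mapGL (u' : GL (Fin N) K) v.1)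
  rw [Subgroup.coe_mul, mapGL_mul]

omit [ValuativeRel K] [(Valued.v : Valuation K ℤᵐ⁰).Compatible] in
/-- `perm (t ^ n) = (perm t) ^ n` for `n ∈ ℤ`. [cite: Serre1980Trees, I.6.4] -/
theorem latticeGraphPerm_zpow (t : ↥(unitaryGroupOfForm σ H)) (n : ℤ) :
    latticeGraphPerm σ ϖ H (t ^ n) = latticeGraphPerm σ ϖ H t ^ n :=
  map_zpow (MonoidHom.mk' (latticeGraphPerm σ ϖ H) (latticeGraphPerm_mul σ ϖ H)) t n

omit [ValuativeRel K] [(Valued.v : Valuation K ℤᵐ⁰).Compatible] in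
/-- `(perm t)^n • v` has underlying lattice `t^n · v`. [cite: Serre1980Trees, I.6.4] -/
theorem latticeGraphPerm_zpow_smul_coe (t : ↥(unitaryGroupOfForm σ H)) (n : ℤ) (v : {M : Submodule (Valued.integer K) (Fin N → K) // IsVertex σ ϖ H M}) :
    (((latticeGraphPerm σ ϖ H t ^ n) • v : {M : Submodule (Valued.integer K) (Fin N → K) // IsVertex σ ϖ H M}) : Submodule (Valued.integer K) (Fin N → K)) =
      mapGL (((t ^ n : ↥(unitaryGroupOfForm σ H))) : GL (Fin N) K) v.1 := by
  rw [← latticeGraphPerm_zpow, Equiv.Perm.smul_def, latticeGraphPerm_apply_coe]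

end Action

/-! ## §2 The three per-level transfers, on any model `eU : G ≃* U(σ, H)` -/

section Levels

variable (σ : K →+* K) (ϖ : K) (H : Matrix (Fin N) (Fin N) K) {G : Type*} [Group G] (eU : G ≃* ↥(unitaryGroupOfForm σ H))

/-- **Level `K₀`: `#(Fix_γ(G⧸C)∕τ^ℤ) = #(fixed self-dual vertices ∕ (perm (eU τ))^ℤ)`** (and `Finite ↔ Finite`) on a model `eU : G ≃* U` with `C ↔ GL_N(𝒪)`, for `γ, τ ∈ G` commuting,
the root self-dual and `U` transitive on self-dual lattices. [cite: Kottwitz1988, §2] [cite: Serre1980Trees, I.6.4] [cite: Laumon1995, Lemma (5.3.2)] -/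
theorem natCard_quotient_orbitRel_fixedBy_glInt_eq_rankN (hL₀ : IsSelfDualLattice σ ϖ H (stdLattice K N))
    (hA : ∀ M : Submodule (Valued.integer K) (Fin N → K), IsSelfDualLattice σ ϖ H M → ∃ u : ↥(unitaryGroupOfForm σ H), mapGL (u : GL (Fin N) K) (stdLattice K N) = M)
    (C : Subgroup G) (hC : ∀ g : G, g ∈ C ↔ ((eU g : ↥(unitaryGroupOfForm σ H)) : GL (Fin N) K) ∈ glInt N K) (γ τ : G) (hτ : τ * γ = γ * τ) :
    Nat.card (Quotient ((orbitRel (Subgroup.zpowers (⟨τ, Subgroup.mem_centralizer_singleton_iff.2 hτ⟩ : Subgroup.centralizer ({γ} : Set G))) (G ⧸ C)).comap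
        (Subtype.val : ↥(fixedBy (G ⧸ C) γ) → G ⧸ C))) =
      Nat.card (Quotient ((orbitRel (Subgroup.zpowers (latticeGraphPerm σ ϖ H (eU τ))) {M : Submodule (Valued.integer K) (Fin N → K) // IsVertex σ ϖ H M}).comap
        (Subtype.val : ↥{v : {M : Submodule (Valued.integer K) (Fin N → K) // IsVertex σ ϖ H M} | latticeGraphIso σ ϖ H (eU γ) v = v ∧ IsSelfDualLattice σ ϖ H v.1} → {M : Submodule (Valued.integer K) (Fin N → K) // IsVertex σ ϖ H M}))) ∧
    (Finite (Quotient ((orbitRel (Subgroup.zpowers (⟨τ, Subgroup.mem_centralizer_singleton_iff.2 hτ⟩ : Subgroup.centralizer ({γ} : Set G))) (G ⧸ C)).comap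
        (Subtype.val : ↥(fixedBy (G ⧸ C) γ) → G ⧸ C))) ↔
      Finite (Quotient ((orbitRel (Subgroup.zpowers (latticeGraphPerm σ ϖ H (eU τ))) {M : Submodule (Valued.integer K) (Fin N → K) // IsVertex σ ϖ H M}).comap
        (Subtype.val : ↥{v : {M : Submodule (Valued.integer K) (Fin N → K) // IsVertex σ ϖ H M} | latticeGraphIso σ ϖ H (eU γ) v = v ∧ IsSelfDualLattice σ ϖ H v.1} → {M : Submodule (Valued.integer K) (Fin N → K) // IsVertex σ ϖ H M})))) := by
  obtain ⟨Φ, hΦ⟩ := exists_equiv_fixedBy_quotient_congr C ((glInt N K).subgroupOf (unitaryGroupOfForm σ H)) eU (fun g => by rw [hC, Subgroup.mem_subgroupOf]) γ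
  obtain ⟨e, he⟩ := exists_fixedBy_equiv_fixed_selfDual_rankN σ ϖ H hL₀ hA (eU γ)
  refine HermitianLatticeTree.natCard_quotient_orbitRel_fixedBy_eq_of_equivariant _ γ τ hτ (latticeGraphPerm σ ϖ H (eU τ)) (Φ.trans e) fun x x' n u hx hx' => ?_
  have hxeq : x = ⟨(u : G ⧸ C), hx ▸ x.2⟩ := Subtype.ext hx
  have hx'eq : x' = ⟨((τ ^ n * u : G) : G ⧸ C), hx' ▸ x'.2⟩ := Subtype.ext hx'
  have hval : ((Φ x : ↥(fixedBy (↥(unitaryGroupOfForm σ H) ⧸ (glInt N K).subgroupOf (unitaryGroupOfForm σ H)) (eU γ))) : ↥(unitaryGroupOfForm σ H) ⧸ (glInt N K).subgroupOf (unitaryGroupOfForm σ H)) = ((eU u : ↥(unitaryGroupOfForm σ H)) : ↥(unitaryGroupOfForm σ H) ⧸ (glInt N K).subgroupOf (unitaryGroupOfForm σ H)) := by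
    rw [hxeq]; exact hΦ u _
  have hval' : ((Φ x' : ↥(fixedBy (↥(unitaryGroupOfForm σ H) ⧸ (glInt N K).subgroupOf (unitaryGroupOfForm σ H)) (eU γ))) : ↥(unitaryGroupOfForm σ H) ⧸ (glInt N K).subgroupOf (unitaryGroupOfForm σ H)) = ((eU (τ ^ n * u) : ↥(unitaryGroupOfForm σ H)) : ↥(unitaryGroupOfForm σ H) ⧸ (glInt N K).subgroupOf (unitaryGroupOfForm σ H)) := by
    rw [hx'eq]; exact hΦ (τ ^ n * u) _
  have hΦx : Φ x = ⟨_, hval ▸ (Φ x).2⟩ := Subtype.ext hval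
  have hΦx' : Φ x' = ⟨_, hval' ▸ (Φ x').2⟩ := Subtype.ext hval'
  apply Subtype.ext
  rw [Equiv.trans_apply, Equiv.trans_apply, latticeGraphPerm_zpow_smul_coe, hΦx, hΦx', he, he, map_mul, map_zpow, Subgroup.coe_mul, mapGL_mul]

/-- **Level `K₁`: `#(Fix_γ(G⧸C)∕τ^ℤ) = #(fixed type-`d` vertices ∕ (perm (eU τ))^ℤ)`** (and `Finite ↔ Finite`) on a model `eU : G ≃* U` with `C ↔ g₁ GL_N(𝒪) g₁⁻¹`, for `γ, τ ∈ G`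
commuting, `g₁·L₀` of type `d` and `U` transitive on type-`d` lattices. [cite: Kottwitz1988, §2] [cite: Serre1980Trees, I.6.4] [cite: Laumon1995, Lemma (5.3.2)] -/
theorem natCard_quotient_orbitRel_fixedBy_conj_glInt_eq_rankN {d : ℕ} {g₁ : GL (Fin N) K} (hg₁ : IsVertexLattice σ ϖ H d (mapGL g₁ (stdLattice K N)))
    (hB : ∀ M : Submodule (Valued.integer K) (Fin N → K), IsVertexLattice σ ϖ H d M → ∃ u : ↥(unitaryGroupOfForm σ H), mapGL ((u : GL (Fin N) K) * g₁) (stdLattice K N) = M)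
    (C : Subgroup G) (hC : ∀ g : G, g ∈ C ↔ ((eU g : ↥(unitaryGroupOfForm σ H)) : GL (Fin N) K) ∈ (glInt N K).map (MulAut.conj g₁).toMonoidHom) (γ τ : G) (hτ : τ * γ = γ * τ) :
    Nat.card (Quotient ((orbitRel (Subgroup.zpowers (⟨τ, Subgroup.mem_centralizer_singleton_iff.2 hτ⟩ : Subgroup.centralizer ({γ} : Set G))) (G ⧸ C)).comap
        (Subtype.val : ↥(fixedBy (G ⧸ C) γ) → G ⧸ C))) =
      Nat.card (Quotient ((orbitRel (Subgroup.zpowers (latticeGraphPerm σ ϖ H (eU τ))) {M : Submodule (Valued.integer K) (Fin N → K) // IsVertex σ ϖ H M}).comap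
        (Subtype.val : ↥{v : {M : Submodule (Valued.integer K) (Fin N → K) // IsVertex σ ϖ H M} | latticeGraphIso σ ϖ H (eU γ) v = v ∧ IsVertexLattice σ ϖ H d v.1} → {M : Submodule (Valued.integer K) (Fin N → K) // IsVertex σ ϖ H M}))) ∧
    (Finite (Quotient ((orbitRel (Subgroup.zpowers (⟨τ, Subgroup.mem_centralizer_singleton_iff.2 hτ⟩ : Subgroup.centralizer ({γ} : Set G))) (G ⧸ C)).comap
        (Subtype.val : ↥(fixedBy (G ⧸ C) γ) → G ⧸ C))) ↔
      Finite (Quotient ((orbitRel (Subgroup.zpowers (latticeGraphPerm σ ϖ H (eU τ))) {M : Submodule (Valued.integer K) (Fin N → K) // IsVertex σ ϖ H M}).comap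
        (Subtype.val : ↥{v : {M : Submodule (Valued.integer K) (Fin N → K) // IsVertex σ ϖ H M} | latticeGraphIso σ ϖ H (eU γ) v = v ∧ IsVertexLattice σ ϖ H d v.1} → {M : Submodule (Valued.integer K) (Fin N → K) // IsVertex σ ϖ H M})))) := by
  obtain ⟨Φ, hΦ⟩ := exists_equiv_fixedBy_quotient_congr C (((glInt N K).map (MulAut.conj g₁).toMonoidHom).subgroupOf (unitaryGroupOfForm σ H)) eU
    (fun g => by rw [hC, Subgroup.mem_subgroupOf]) γ
  obtain ⟨e, he⟩ := exists_fixedBy_conj_equiv_fixed_type σ ϖ H hg₁ hB (eU γ)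
  refine HermitianLatticeTree.natCard_quotient_orbitRel_fixedBy_eq_of_equivariant _ γ τ hτ (latticeGraphPerm σ ϖ H (eU τ)) (Φ.trans e) fun x x' n u hx hx' => ?_
  have hxeq : x = ⟨(u : G ⧸ C), hx ▸ x.2⟩ := Subtype.ext hx
  have hx'eq : x' = ⟨((τ ^ n * u : G) : G ⧸ C), hx' ▸ x'.2⟩ := Subtype.ext hx'
  have hval : ((Φ x : ↥(fixedBy (↥(unitaryGroupOfForm σ H) ⧸ ((glInt N K).map (MulAut.conj g₁).toMonoidHom).subgroupOf (unitaryGroupOfForm σ H)) (eU γ))) : ↥(unitaryGroupOfForm σ H) ⧸ ((glInt N K).map (MulAut.conj g₁).toMonoidHom).subgroupOf (unitaryGroupOfForm σ H)) = ((eU u : ↥(unitaryGroupOfForm σ H)) : ↥(unitaryGroupOfForm σ H) ⧸ ((glInt N K).map (MulAut.conj g₁).toMonoidHom).subgroupOf (unitaryGroupOfForm σ H)) := by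
    rw [hxeq]; exact hΦ u _
  have hval' : ((Φ x' : ↥(fixedBy (↥(unitaryGroupOfForm σ H) ⧸ ((glInt N K).map (MulAut.conj g₁).toMonoidHom).subgroupOf (unitaryGroupOfForm σ H)) (eU γ))) : ↥(unitaryGroupOfForm σ H) ⧸ ((glInt N K).map (MulAut.conj g₁).toMonoidHom).subgroupOf (unitaryGroupOfForm σ H)) = ((eU (τ ^ n * u) : ↥(unitaryGroupOfForm σ H)) : ↥(unitaryGroupOfForm σ H) ⧸ ((glInt N K).map (MulAut.conj g₁).toMonoidHom).subgroupOf (unitaryGroupOfForm σ H)) := by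
    rw [hx'eq]; exact hΦ (τ ^ n * u) _
  have hΦx : Φ x = ⟨_, hval ▸ (Φ x).2⟩ := Subtype.ext hval
  have hΦx' : Φ x' = ⟨_, hval' ▸ (Φ x').2⟩ := Subtype.ext hval'
  apply Subtype.ext
  rw [Equiv.trans_apply, Equiv.trans_apply, latticeGraphPerm_zpow_smul_coe, hΦx, hΦx', he, he, map_mul, map_zpow, Subgroup.coe_mul, mul_assoc, mapGL_mul]

/-- **Level `K₀ ⊓ K₁`: `#(Fix_γ(G⧸C)∕τ^ℤ) = #(fixed flags ∕ (perm (eU τ))^ℤ)`** (and `Finite ↔ Finite`; the permutation acting diagonally on pairs of vertices) on a model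
`eU : G ≃* U` with `C ↔ GL_N(𝒪) ∩ g₁ GL_N(𝒪) g₁⁻¹`, for `γ, τ ∈ G` commuting, the root self-dual, `g₁·L₀ < L₀` of type `d` and `U` transitive on such flags.
[cite: Kottwitz1988, §2] [cite: Serre1980Trees, I.6.4] [cite: Laumon1995, Lemma (5.3.2)] -/
theorem natCard_quotient_orbitRel_fixedBy_inf_eq_rankN (hL₀ : IsSelfDualLattice σ ϖ H (stdLattice K N)) {d : ℕ} {g₁ : GL (Fin N) K}
    (hg₁ : IsVertexLattice σ ϖ H d (mapGL g₁ (stdLattice K N))) (hlt₁ : mapGL g₁ (stdLattice K N) < stdLattice K N)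
    (hI : ∀ L M : Submodule (Valued.integer K) (Fin N → K), IsSelfDualLattice σ ϖ H L → IsVertexLattice σ ϖ H d M → M < L →
      ∃ u : ↥(unitaryGroupOfForm σ H), mapGL (u : GL (Fin N) K) (stdLattice K N) = L ∧ mapGL ((u : GL (Fin N) K) * g₁) (stdLattice K N) = M)
    (C : Subgroup G) (hC : ∀ g : G, g ∈ C ↔ ((eU g : ↥(unitaryGroupOfForm σ H)) : GL (Fin N) K) ∈ glInt N K ∧ ((eU g : ↥(unitaryGroupOfForm σ H)) : GL (Fin N) K) ∈ (glInt N K).map (MulAut.conj g₁).toMonoidHom)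
    (γ τ : G) (hτ : τ * γ = γ * τ) :
    Nat.card (Quotient ((orbitRel (Subgroup.zpowers (⟨τ, Subgroup.mem_centralizer_singleton_iff.2 hτ⟩ : Subgroup.centralizer ({γ} : Set G))) (G ⧸ C)).comap
        (Subtype.val : ↥(fixedBy (G ⧸ C) γ) → G ⧸ C))) =
      Nat.card (Quotient ((orbitRel (Subgroup.zpowers (latticeGraphPerm σ ϖ H (eU τ))) ({M : Submodule (Valued.integer K) (Fin N → K) // IsVertex σ ϖ H M} × {M : Submodule (Valued.integer K) (Fin N → K) // IsVertex σ ϖ H M})).comap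
        (Subtype.val : {p : {M : Submodule (Valued.integer K) (Fin N → K) // IsVertex σ ϖ H M} × {M : Submodule (Valued.integer K) (Fin N → K) // IsVertex σ ϖ H M} //
            IsSelfDualLattice σ ϖ H p.1.1 ∧ IsVertexLattice σ ϖ H d p.2.1 ∧ p.2.1 < p.1.1 ∧ latticeGraphIso σ ϖ H (eU γ) p.1 = p.1 ∧ latticeGraphIso σ ϖ H (eU γ) p.2 = p.2} →
          {M : Submodule (Valued.integer K) (Fin N → K) // IsVertex σ ϖ H M} × {M : Submodule (Valued.integer K) (Fin N → K) // IsVertex σ ϖ H M}))) ∧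
    (Finite (Quotient ((orbitRel (Subgroup.zpowers (⟨τ, Subgroup.mem_centralizer_singleton_iff.2 hτ⟩ : Subgroup.centralizer ({γ} : Set G))) (G ⧸ C)).comap
        (Subtype.val : ↥(fixedBy (G ⧸ C) γ) → G ⧸ C))) ↔
      Finite (Quotient ((orbitRel (Subgroup.zpowers (latticeGraphPerm σ ϖ H (eU τ))) ({M : Submodule (Valued.integer K) (Fin N → K) // IsVertex σ ϖ H M} × {M : Submodule (Valued.integer K) (Fin N → K) // IsVertex σ ϖ H M})).comap
        (Subtype.val : {p : {M : Submodule (Valued.integer K) (Fin N → K) // IsVertex σ ϖ H M} × {M : Submodule (Valued.integer K) (Fin N → K) // IsVertex σ ϖ H M} //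
            IsSelfDualLattice σ ϖ H p.1.1 ∧ IsVertexLattice σ ϖ H d p.2.1 ∧ p.2.1 < p.1.1 ∧ latticeGraphIso σ ϖ H (eU γ) p.1 = p.1 ∧ latticeGraphIso σ ϖ H (eU γ) p.2 = p.2} →
          {M : Submodule (Valued.integer K) (Fin N → K) // IsVertex σ ϖ H M} × {M : Submodule (Valued.integer K) (Fin N → K) // IsVertex σ ϖ H M})))) := by
  obtain ⟨Φ, hΦ⟩ := exists_equiv_fixedBy_quotient_congr C
    ((glInt N K).subgroupOf (unitaryGroupOfForm σ H) ⊓ ((glInt N K).map (MulAut.conj g₁).toMonoidHom).subgroupOf (unitaryGroupOfForm σ H)) eU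
    (fun g => by rw [hC, Subgroup.mem_inf, Subgroup.mem_subgroupOf, Subgroup.mem_subgroupOf]) γ
  obtain ⟨e, he⟩ := exists_fixedBy_inf_equiv_fixed_flags_rankN σ ϖ H hL₀ hg₁ hlt₁ hI (eU γ)
  refine HermitianLatticeTree.natCard_quotient_orbitRel_fixedBy_eq_of_equivariant _ γ τ hτ (latticeGraphPerm σ ϖ H (eU τ)) (Φ.trans e) fun x x' n u hx hx' => ?_
  have hxeq : x = ⟨(u : G ⧸ C), hx ▸ x.2⟩ := Subtype.ext hx
  have hx'eq : x' = ⟨((τ ^ n * u : G) : G ⧸ C), hx' ▸ x'.2⟩ := Subtype.ext hx'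
  have hval : ((Φ x : ↥(fixedBy (↥(unitaryGroupOfForm σ H) ⧸ ((glInt N K).subgroupOf (unitaryGroupOfForm σ H) ⊓ ((glInt N K).map (MulAut.conj g₁).toMonoidHom).subgroupOf (unitaryGroupOfForm σ H))) (eU γ))) : ↥(unitaryGroupOfForm σ H) ⧸ ((glInt N K).subgroupOf (unitaryGroupOfForm σ H) ⊓ ((glInt N K).map (MulAut.conj g₁).toMonoidHom).subgroupOf (unitaryGroupOfForm σ H))) = ((eU u : ↥(unitaryGroupOfForm σ H)) : ↥(unitaryGroupOfForm σ H) ⧸ ((glInt N K).subgroupOf (unitaryGroupOfForm σ H) ⊓ ((glInt N K).map (MulAut.conj g₁).toMonoidHom).subgroupOf (unitaryGroupOfForm σ H))) := by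
    rw [hxeq]; exact hΦ u _
  have hval' : ((Φ x' : ↥(fixedBy (↥(unitaryGroupOfForm σ H) ⧸ ((glInt N K).subgroupOf (unitaryGroupOfForm σ H) ⊓ ((glInt N K).map (MulAut.conj g₁).toMonoidHom).subgroupOf (unitaryGroupOfForm σ H))) (eU γ))) : ↥(unitaryGroupOfForm σ H) ⧸ ((glInt N K).subgroupOf (unitaryGroupOfForm σ H) ⊓ ((glInt N K).map (MulAut.conj g₁).toMonoidHom).subgroupOf (unitaryGroupOfForm σ H))) = ((eU (τ ^ n * u) : ↥(unitaryGroupOfForm σ H)) : ↥(unitaryGroupOfForm σ H) ⧸ ((glInt N K).subgroupOf (unitaryGroupOfForm σ H) ⊓ ((glInt N K).map (MulAut.conj g₁).toMonoidHom).subgroupOf (unitaryGroupOfForm σ H))) := by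
    rw [hx'eq]; exact hΦ (τ ^ n * u) _
  have hΦx : Φ x = ⟨_, hval ▸ (Φ x).2⟩ := Subtype.ext hval
  have hΦx' : Φ x' = ⟨_, hval' ▸ (Φ x').2⟩ := Subtype.ext hval'
  obtain ⟨h1, h2⟩ := he _ (hval ▸ (Φ x).2)
  obtain ⟨h1', h2'⟩ := he _ (hval' ▸ (Φ x').2)
  rw [Equiv.trans_apply, Equiv.trans_apply, hΦx, hΦx']
  refine Prod.ext (Subtype.ext ?_) (Subtype.ext ?_)
  · rw [Prod.smul_fst, latticeGraphPerm_zpow_smul_coe, h1, h1', map_mul, map_zpow, Subgroup.coe_mul, mapGL_mul]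
  · rw [Prod.smul_snd, latticeGraphPerm_zpow_smul_coe, h2, h2', map_mul, map_zpow, Subgroup.coe_mul, mul_assoc, mapGL_mul]

end Levels

end Literature.NumberTheory.Automorphic.UnitaryLatticeTree

end
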